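import Summits.BirchSwinnertonDyer.BirchSwinnertonDyer.Theorems.AdditiveKolyvaginRoadBaseSwitchAtVisibleVertex
import Summits.BirchSwinnertonDyer.BirchSwinnertonDyer.Theorems.AdditiveKolyvaginRoadLevelJumpAboveP
import Summits.BirchSwinnertonDyer.BirchSwinnertonDyer.Theorems.AdditiveKolyvaginRoadLocalDictionaries
import Summits.BirchSwinnertonDyer.BirchSwinnertonDyer.Theorems.AdditiveKolyvaginRoadToricDictionary
import HarnessLib

/-!
# Route `AdditiveKolyvaginRoad`, crux KS′ `LevelKolyvaginSystemsAdditive` (stmt-BirchSwinnertonDyer-21396) ∕ KPA′ (stmt-BirchSwinnertonDyer-21400):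
# POITOU–TATE AT A VISIBLE CORE VERTEX, LEVEL FORM — `Sel_{∅,0}(K, E[p])_{n} = 0 = Sel_{0,∅}` at a level `n` whose canonical sign-free Selmer group
# has order `p` and is visible at both places above `p` (step (5) of THE CHAIN of card `pointwise-klingen-seed`)
# (cell `pub/bsd-wall`, width seat `bsd-wall-akr-p2x-w4` g5; `--supports stmt-BirchSwinnertonDyer-21396`, helper; E-side glue)

WHY. Card `Cruxes/LevelKolyvaginSystemsAdditive/Ideas/pointwise-klingen-seed.md`, THE CHAIN: «S-vis gives `n₀`; `E(ℚ_p)[p] = 0 ⇒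
Sel_{∅,0}(K,E[p])_{n₀} = 0 = Sel_{0,∅}` (5) ⇒ [Urban/SU lattice …]». S-vis (akr-p2x-w2 g9, `…VisibleEvenCoreLevel`) produces the level `n₀`; this file is
(5): the canonical level-`n` Selmer structure `𝓑_n` of this crux (E's Kummer conditions at `∞` and at the finite places above no prime of `n`, the TORIC
condition `toricLocalCondition` above the primes of `n`) is a self-dual base in the sense of `VisibleVertex.selmerGroup_update_top_bot_card_eq_one_of_base`
(toric = Lagrangian: `htorIso_toricLocalCondition` + `natCard_galoisCohomology_one_le_mul_natCard_toricLocalCondition`, exactly as in `…LevelJumpAboveP`), so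
at a ♯ frame on the `LocIrr` locus, if the sign-free level-`n` group `D_n` has order `p` and no non-zero class of `D_n` is locally trivial at a place above
`p`, then every class satisfying the level-`n` conditions off `𝔭, 𝔭'`, NO condition at `𝔭` and the STRICT condition at `𝔭'` is ZERO.

WHAT (namespace `…Theorems.AdditiveKoly.VisibleVertex`; `D_n` is written as the explicit intersection of the route's local kernels).
* **`eq_zero_of_level_relaxed_strict_of_visible`** — frame `K` imaginary quadratic + Heegner for `N_E`, `p ∣ N_E`, `p ≠ 2`, `LocIrr W p`, `𝔭 ≠ 𝔭'`
  above `p`, `n : Finset (AdmQ W K p)`; `#D_n = p`; visibility of `D_n ∖ 0` above `p`; then `Sel_{∅,0}(n) = 0` in membership form.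
  The mirror `Sel_{0,∅}(n) = 0` is the same statement with `𝔭`, `𝔭'` exchanged (all hypotheses are symmetric).

HONEST FRAMING: theorems only; 0 definitions, 0 named facts, 0 `sorry`; E-side glue over S-vis's output shape (sign-free form; the eigen-form bridge
`dim Sel_n⁺ + dim Sel_n⁻ = 1 ⇒ #D_n = p` is `finrank_switched_empty_eq_eigen_add` ∕ `finrank_eq_eigen_add_of_odd` and is left to the consumer); closes
nothing; the automorphic half of the chain ((E1), FPK, the U(3,1) lattice) is untouched. BSD is not proved by any of this; KS′/KPA′ stay OPEN at `p² ∣ N`.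

References: [cite: MilneADT2006, Ch. I, Cor. 2.3, Thm. 4.10] [cite: Howard2004HeegnerKolyvagin, Thm. 2.1.11] [cite: BertoliniDarmon2005, §2.2–§2.3, Lemma 2.6]
[cite: WZhang2014, Lemma 5.3, Prop. 5.4] [cite: JetchevSkinnerWan2017, (3.5.d)].
-/

-- single-conjunct summit: `Summit.BirchSwinnertonDyer.BirchSwinnertonDyer.…` repeats the name by design
set_option linter.dupNamespace false
set_option autoImplicit false

noncomputable section

open scoped Classical NumberField

namespace Summit.BirchSwinnertonDyer.BirchSwinnertonDyer.Theorems.AdditiveKoly.VisibleVertex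

open Function NumberField IsDedekindDomain Field WeierstrassCurve
open Literature.NumberTheory.EllipticCurves Literature.NumberTheory.EllipticCurves.Rank1Residual
  Literature.NumberTheory.EllipticCurves.ModularForms
open Literature.NumberTheory.GaloisRepresentations Literature.NumberTheory.GaloisRepresentations.DiscreteGaloisModule
open Literature.NumberTheory.GaloisCohomology
open Summit.BirchSwinnertonDyer.Rank1Residual.X11b.FiniteDuality
open Summit.BirchSwinnertonDyer.Rank1Residual.X11b.Relaxation
open Summit.BirchSwinnertonDyer.Rank1Residual.X11b.LocBridge
open Summit.BirchSwinnertonDyer.Rank1Residual.X11b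
open Summit.BirchSwinnertonDyer.Rank1Residual.GaloisImage
open Summit.BirchSwinnertonDyer.Rank1Residual.X11b.Three.Koly.ZhangSupply
open Summit.BirchSwinnertonDyer.Rank1Residual.X11b.Three.Koly.Method2
open Summit.BirchSwinnertonDyer.Rank1Residual.X11b.KummerPT
open Summit.BirchSwinnertonDyer.Rank1Residual.Additive
open scoped ContRepresentation

section Level

variable (W : WeierstrassCurve ℚ) [W.IsElliptic] [W.IsGloballyMinimal] (K : Type) [Field K] [NumberField K] (p : ℕ) [Fact p.Prime]
  [∀ v : Place K, CompactSpace (absoluteGaloisGroup (Place.Completion v))]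

/-- **`Sel_{∅,0}(K, E[p])_n = 0` AT A VISIBLE VERTEX OF ORDER `p` (step (5) of card `pointwise-klingen-seed`).** Frame: `W/ℚ`, `K` imaginary quadratic with
the Heegner hypothesis for `N_E`, `p ∣ N_E`, `p ≠ 2`, `LocIrr W p`, `𝔭 ≠ 𝔭'` places of `K` above `p`, `n` a finite set of BD-admissible primes. Let `D_n` be the
sign-free canonical level-`n` group (Kummer at `∞` and at the finite places above no prime of `n`, toric above the primes of `n`). If `#D_n = p` and every
class of `D_n` that is locally trivial at SOME place above `p` is zero, then every `x ∈ H¹(K, E[p])` that is Kummer at `∞`, Kummer at the finite `v ≠ 𝔭, 𝔭'`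
above no prime of `n`, toric above the primes of `n`, and locally trivial at `𝔭'` (nothing asked at `𝔭`) is ZERO. [cite: MilneADT2006, Ch. I, Thm. 4.10]
[cite: Howard2004HeegnerKolyvagin, Thm. 2.1.11] [cite: BertoliniDarmon2005, §2.3, Lemma 2.6] -/
theorem eq_zero_of_level_relaxed_strict_of_visible (hK : IsImaginaryQuadratic K)
    (hH : SatisfiesHeegnerHypothesis (W.conductorNorm ℤ) K) (hpN : p ∣ W.conductorNorm ℤ) (hp2 : p ≠ 2) (hL : LocIrr W p)
    (n : Finset (AdmQ W K p)) (𝔭 𝔭' : HeightOneSpectrum (𝓞 K)) (hne : 𝔭 ≠ 𝔭')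
    (h𝔭 : ((p : ℕ) : 𝓞 K) ∈ 𝔭.asIdeal) (h𝔭' : ((p : ℕ) : 𝓞 K) ∈ 𝔭'.asIdeal)
    (hcard : Nat.card ((⨅ (u : InfinitePlace K), selmerLocalKer (W.baseChange K) u.Completion ((p ^ 1 : ℕ) : ℤ)) ⊓
        (⨅ (v : HeightOneSpectrum (𝓞 K)) (_ : ∀ q ∈ n, ((q : ℕ) : 𝓞 K) ∉ v.asIdeal),
          selmerLocalKer (W.baseChange K) (v.adicCompletion K) ((p ^ 1 : ℕ) : ℤ)) ⊓
        (⨅ (v : HeightOneSpectrum (𝓞 K)) (_ : ∃ q ∈ n, ((q : ℕ) : 𝓞 K) ∈ v.asIdeal),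
          toricLocalKer (W.baseChange K) (v.adicCompletion K) ((p ^ 1 : ℕ) : ℤ)) : AddSubgroup (Vp W K p)) = p)
    (hvis : ∀ x ∈ ((⨅ (u : InfinitePlace K), selmerLocalKer (W.baseChange K) u.Completion ((p ^ 1 : ℕ) : ℤ)) ⊓
        (⨅ (v : HeightOneSpectrum (𝓞 K)) (_ : ∀ q ∈ n, ((q : ℕ) : 𝓞 K) ∉ v.asIdeal),
          selmerLocalKer (W.baseChange K) (v.adicCompletion K) ((p ^ 1 : ℕ) : ℤ)) ⊓
        (⨅ (v : HeightOneSpectrum (𝓞 K)) (_ : ∃ q ∈ n, ((q : ℕ) : 𝓞 K) ∈ v.asIdeal),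
          toricLocalKer (W.baseChange K) (v.adicCompletion K) ((p ^ 1 : ℕ) : ℤ)) : AddSubgroup (Vp W K p)),
      ∀ w : HeightOneSpectrum (𝓞 K), ((p : ℕ) : 𝓞 K) ∈ w.asIdeal →
        x ∈ (W.baseChange K).torsionLocalKer (w.adicCompletion K) ((p ^ 1 : ℕ) : ℤ) → x = 0)
    (x : Vp W K p)
    (hinf : ∀ u : InfinitePlace K, x ∈ selmerLocalKer (W.baseChange K) u.Completion ((p ^ 1 : ℕ) : ℤ))
    (hfin : ∀ v : HeightOneSpectrum (𝓞 K), v ≠ 𝔭 → v ≠ 𝔭' → (∀ q ∈ n, ((q : ℕ) : 𝓞 K) ∉ v.asIdeal) →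
      x ∈ selmerLocalKer (W.baseChange K) (v.adicCompletion K) ((p ^ 1 : ℕ) : ℤ))
    (htor : ∀ v : HeightOneSpectrum (𝓞 K), ∀ q ∈ n, ((q : ℕ) : 𝓞 K) ∈ v.asIdeal →
      x ∈ toricLocalKer (W.baseChange K) (v.adicCompletion K) ((p ^ 1 : ℕ) : ℤ))
    (hstrict : x ∈ (W.baseChange K).torsionLocalKer (𝔭'.adicCompletion K) ((p ^ 1 : ℕ) : ℤ)) :
    x = 0 := by
  have hp : p.Prime := Fact.out
  haveI : NeZero (p ^ 1 : ℕ) := ⟨pow_ne_zero 1 hp.ne_zero⟩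
  have hK2 : Module.finrank ℚ K = 2 := hK.1
  -- the canonical level-`n` structure `𝓑`: Kummer at `∞` and off `n`, toric above `n`
  set 𝓚 : SelmerStructure ((W.baseChange K).torsionGaloisModule ((p ^ 1 : ℕ) : ℤ)) :=
    (W.baseChange K).kummerSelmerStructure ((p ^ 1 : ℕ) : ℤ) with h𝓚
  let Ltor : (v : HeightOneSpectrum (𝓞 K)) →
      AddSubgroup (galoisCohomology (((W.baseChange K).torsionGaloisModule ((p ^ 1 : ℕ) : ℤ)).toLocal (Sum.inr v)) 1) :=
    fun v ↦ toricLocalCondition (W.baseChange K) (v.adicCompletion K) ((p ^ 1 : ℕ) : ℤ)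
  let 𝓑 : SelmerStructure ((W.baseChange K).torsionGaloisModule ((p ^ 1 : ℕ) : ℤ)) := fun v ↦
    match v with
    | Sum.inl u => 𝓚 (Sum.inl u)
    | Sum.inr v => if (∃ q ∈ n, ((q : ℕ) : 𝓞 K) ∈ v.asIdeal) then Ltor v else 𝓚 (Sum.inr v)
  have h𝓑_inl : ∀ u : InfinitePlace K, 𝓑 (Sum.inl u) = 𝓚 (Sum.inl u) := fun _ ↦ rfl
  have h𝓑_n : ∀ v : HeightOneSpectrum (𝓞 K), (∃ q ∈ n, ((q : ℕ) : 𝓞 K) ∈ v.asIdeal) → 𝓑 (Sum.inr v) = Ltor v :=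
    fun v hv ↦ by change (if _ then _ else _) = _; rw [if_pos hv]
  have h𝓑_K : ∀ v : HeightOneSpectrum (𝓞 K), (¬ ∃ q ∈ n, ((q : ℕ) : 𝓞 K) ∈ v.asIdeal) → 𝓑 (Sum.inr v) = 𝓚 (Sum.inr v) :=
    fun v hv ↦ by change (if _ then _ else _) = _; rw [if_neg hv]
  -- the finite set `U` of places above the level
  have hnfin : {v : HeightOneSpectrum (𝓞 K) | ∃ q ∈ n, ((q : ℕ) : 𝓞 K) ∈ v.asIdeal}.Finite := by
    have hq : ∀ q : AdmQ W K p, {v : HeightOneSpectrum (𝓞 K) | ((q : ℕ) : 𝓞 K) ∈ v.asIdeal}.Finite := by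
      intro q
      have hq0 : (Ideal.span {((q : ℕ) : 𝓞 K)} : Ideal (𝓞 K)) ≠ 0 := by
        rw [Ne, Ideal.zero_eq_bot, Ideal.span_singleton_eq_bot]
        exact_mod_cast q.2.1.ne_zero
      exact (Ideal.finite_factors hq0).subset fun v hv ↦ (Ideal.dvd_span_singleton).mpr hv
    refine ((n : Set (AdmQ W K p)).toFinite.biUnion fun q _ ↦ hq q).subset ?_
    intro v hv
    obtain ⟨q, hqn, hqv⟩ := hv
    exact Set.mem_biUnion (Finset.mem_coe.mpr hqn) hqv
  set U : Finset (HeightOneSpectrum (𝓞 K)) := hnfin.toFinset with hU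
  have hUmem : ∀ v : HeightOneSpectrum (𝓞 K), v ∈ U ↔ ∃ q ∈ n, ((q : ℕ) : 𝓞 K) ∈ v.asIdeal := fun v ↦ by
    rw [hU, Set.Finite.mem_toFinset]; rfl
  have h𝓑K : ∀ v : Place K, (∀ u ∈ U, v ≠ Sum.inr u) → 𝓑 v = 𝓚 v := by
    intro v hv
    rcases v with u | v
    · exact h𝓑_inl u
    · refine h𝓑_K v fun h ↦ hv v ((hUmem v).mpr h) rfl
  have h𝓑lag : ∀ (e : geomTorsion (W.baseChange K) ((p ^ 1 : ℕ) : ℤ) → geomTorsion (W.baseChange K) ((p ^ 1 : ℕ) : ℤ) →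
        AlgebraicClosure K)
      (hμ : ∀ S T, e S T ^ (p ^ 1) = 1)
      (hadd₁ : ∀ S₁ S₂ T, e (S₁ + S₂) T = e S₁ T * e S₂ T)
      (hadd₂ : ∀ S T₁ T₂, e S (T₁ + T₂) = e S T₁ * e S T₂)
      (hgal : ∀ (σ : absoluteGaloisGroup K) (S T : geomTorsion (W.baseChange K) ((p ^ 1 : ℕ) : ℤ)),
        σ • e S T = e (σ • S) (σ • T)),
      (∀ T, e T T = 1) → (∀ T, (∀ S, e S T = 1) → T = 0) →
      ∀ inv : LocalInvariants K (p ^ 1), inv.IsPerfect →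
      ∀ u ∈ U, annRight (invWeilPairing (W.baseChange K) (p ^ 1) e hμ hadd₁ hadd₂ hgal inv (Sum.inr u)) (𝓑 (Sum.inr u)) =
        𝓑 (Sum.inr u) := by
    intro e hμ hadd₁ hadd₂ hgal halt hnondeg inv hperf u hu
    obtain ⟨q, hq, hqu⟩ := (hUmem u).mp hu
    rw [h𝓑_n u ⟨q, hq, hqu⟩]
    exact annRight_invWeilPairing_eq_of_isotropic_of_card_le (W.baseChange K) (p ^ 1) e hμ hadd₁ hadd₂ hgal
      hnondeg inv u (hperf u).1.1 (Ltor u)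
      (fun a ha b hb ↦ htorIso_toricLocalCondition W K p hK2 q u hqu e hμ hadd₁ hadd₂ halt hgal a ha b hb)
      (natCard_galoisCohomology_one_le_mul_natCard_toricLocalCondition W K p hK2 q u hqu)
  -- `D_n = H¹_𝓑`
  have hD : ∀ y : Vp W K p, y ∈ ((⨅ (u : InfinitePlace K), selmerLocalKer (W.baseChange K) u.Completion ((p ^ 1 : ℕ) : ℤ)) ⊓
        (⨅ (v : HeightOneSpectrum (𝓞 K)) (_ : ∀ q ∈ n, ((q : ℕ) : 𝓞 K) ∉ v.asIdeal),
          selmerLocalKer (W.baseChange K) (v.adicCompletion K) ((p ^ 1 : ℕ) : ℤ)) ⊓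
        (⨅ (v : HeightOneSpectrum (𝓞 K)) (_ : ∃ q ∈ n, ((q : ℕ) : 𝓞 K) ∈ v.asIdeal),
          toricLocalKer (W.baseChange K) (v.adicCompletion K) ((p ^ 1 : ℕ) : ℤ)) : AddSubgroup (Vp W K p)) ↔
      y ∈ 𝓑.selmerGroup := by
    intro y
    simp only [AddSubgroup.mem_inf, AddSubgroup.mem_iInf]
    constructor
    · rintro ⟨⟨hyinf, hyfin⟩, hytor⟩
      refine (SelmerStructure.mem_selmerGroup_iff _ _).mpr fun v ↦ ?_
      rcases v with u | v
      · rw [h𝓑_inl u, h𝓚, WeierstrassCurve.kummerSelmerStructure_apply]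
        exact (mem_selmerLocalKer_iff_localization_mem_kummer_inf_P W K p u y).mp (hyinf u)
      · by_cases hv : ∃ q ∈ n, ((q : ℕ) : 𝓞 K) ∈ v.asIdeal
        · rw [h𝓑_n v hv]
          exact (mem_toricLocalKer_iff_res_mem_toricLocalCondition (W.baseChange K) (p ^ 1) (v.adicCompletion K) y).mp
            (hytor v hv)
        · rw [h𝓑_K v hv, h𝓚, WeierstrassCurve.kummerSelmerStructure_apply]
          push Not at hv
          exact (mem_selmerLocalKer_iff_localization_mem_kummer_P W K p v y).mp (hyfin v hv)
    · intro hy0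
      have hy := (SelmerStructure.mem_selmerGroup_iff _ _).mp hy0
      refine ⟨⟨fun u ↦ ?_, fun v hv ↦ ?_⟩, fun v hv ↦ ?_⟩
      · refine (mem_selmerLocalKer_iff_localization_mem_kummer_inf_P W K p u y).mpr ?_
        have h := hy (Sum.inl u)
        rw [h𝓑_inl u, h𝓚, WeierstrassCurve.kummerSelmerStructure_apply] at h
        exact h
      · refine (mem_selmerLocalKer_iff_localization_mem_kummer_P W K p v y).mpr ?_
        have h := hy (Sum.inr v)
        rw [h𝓑_K v (fun ⟨q, hq, hqv⟩ ↦ hv q hq hqv), h𝓚, WeierstrassCurve.kummerSelmerStructure_apply] at h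
        exact h
      · have h := hy (Sum.inr v)
        rw [h𝓑_n v hv] at h
        exact mem_toricLocalKer_of_res_mem_toricLocalCondition (W.baseChange K) (p ^ 1) (v.adicCompletion K) h
  have hDeq : ((⨅ (u : InfinitePlace K), selmerLocalKer (W.baseChange K) u.Completion ((p ^ 1 : ℕ) : ℤ)) ⊓
        (⨅ (v : HeightOneSpectrum (𝓞 K)) (_ : ∀ q ∈ n, ((q : ℕ) : 𝓞 K) ∉ v.asIdeal),
          selmerLocalKer (W.baseChange K) (v.adicCompletion K) ((p ^ 1 : ℕ) : ℤ)) ⊓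
        (⨅ (v : HeightOneSpectrum (𝓞 K)) (_ : ∃ q ∈ n, ((q : ℕ) : 𝓞 K) ∈ v.asIdeal),
          toricLocalKer (W.baseChange K) (v.adicCompletion K) ((p ^ 1 : ℕ) : ℤ)) : AddSubgroup (Vp W K p)) =
      𝓑.selmerGroup := by
    ext y
    exact hD y
  have hSel : Nat.card 𝓑.selmerGroup = p := by rw [← hDeq]; exact hcard
  have hinjw : ∀ w : HeightOneSpectrum (𝓞 K), ((p : ℕ) : 𝓞 K) ∈ w.asIdeal → ∀ y ∈ 𝓑.selmerGroup,
      galoisCohomology.localization ((W.baseChange K).torsionGaloisModule ((p ^ 1 : ℕ) : ℤ)) (Sum.inr w : Place K) 1 y = 0 →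
        y = 0 := by
    intro w hw y hy hy0
    refine hvis y ((hD y).mpr hy) w hw ?_
    exact (mem_torsionLocalKer_iff_localization_eq_zero_P W K p w y).mpr hy0
  -- the switched structure has trivial Selmer group
  have hone := selmerGroup_update_top_bot_card_eq_one_of_base_of_locIrr W K p hK hH hpN hp2 hL 𝓑 U h𝓑K h𝓑lag 𝔭 𝔭' hne h𝔭
    hSel (hinjw 𝔭 h𝔭) (hinjw 𝔭' h𝔭')
  -- and `x` lies in it
  have hx : x ∈ SelmerStructure.selmerGroup
      (Function.update (Function.update 𝓑 (Sum.inr 𝔭 : Place K) ⊤) (Sum.inr 𝔭' : Place K) ⊥ :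
        SelmerStructure ((W.baseChange K).torsionGaloisModule ((p ^ 1 : ℕ) : ℤ))) := by
    refine (SelmerStructure.mem_selmerGroup_iff _ _).mpr fun v ↦ ?_
    by_cases hv' : v = Sum.inr 𝔭'
    · subst hv'
      rw [Function.update_self]
      exact (AddSubgroup.mem_bot).mpr ((mem_torsionLocalKer_iff_localization_eq_zero_P W K p 𝔭' x).mp hstrict)
    · rw [Function.update_of_ne hv']
      by_cases hv : v = Sum.inr 𝔭
      · subst hv
        rw [Function.update_self]
        exact AddSubgroup.mem_top _
      · rw [Function.update_of_ne hv]
        rcases v with u | v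
        · rw [h𝓑_inl u, h𝓚, WeierstrassCurve.kummerSelmerStructure_apply]
          exact (mem_selmerLocalKer_iff_localization_mem_kummer_inf_P W K p u x).mp (hinf u)
        · have hv1 : v ≠ 𝔭 := fun h ↦ hv (by rw [h])
          have hv2 : v ≠ 𝔭' := fun h ↦ hv' (by rw [h])
          by_cases hvn : ∃ q ∈ n, ((q : ℕ) : 𝓞 K) ∈ v.asIdeal
          · rw [h𝓑_n v hvn]
            obtain ⟨q, hq, hqv⟩ := hvn
            exact (mem_toricLocalKer_iff_res_mem_toricLocalCondition (W.baseChange K) (p ^ 1) (v.adicCompletion K) x).mp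
              (htor v q hq hqv)
          · rw [h𝓑_K v hvn, h𝓚, WeierstrassCurve.kummerSelmerStructure_apply]
            push Not at hvn
            exact (mem_selmerLocalKer_iff_localization_mem_kummer_P W K p v x).mp (hfin v hv1 hv2 hvn)
  have hbot : SelmerStructure.selmerGroup
      (Function.update (Function.update 𝓑 (Sum.inr 𝔭 : Place K) ⊤) (Sum.inr 𝔭' : Place K) ⊥ :
        SelmerStructure ((W.baseChange K).torsionGaloisModule ((p ^ 1 : ℕ) : ℤ))) = ⊥ :=
    AddSubgroup.card_eq_one.mp hone
  rw [hbot] at hx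
  exact (AddSubgroup.mem_bot).mp hx

end Level

end Summit.BirchSwinnertonDyer.BirchSwinnertonDyer.Theorems.AdditiveKoly.VisibleVertex

end
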